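import Summits.CriticalPhenomena.SAWScalingLimit.Theorems.SAWDefectDecoherenceMassRatioRenewalDictionaryA

/-!
# Crux `SAWDefectDecoherence.MassRatio` (stmt-CriticalPhenomena-8550), line `renewal-averaging-at-b`:
# the bridge dictionary, part B — box bridges at the door `(0,0)` are the DCS strip bridges

Part B of the proof of the registered stub `stub_bridgeDictionary : BridgeDictionary kernel HV.stripBlim`
(part A, `…RenewalDictionaryA.lean`: translation invariance, window monotonicity, parity).  The
b-side module of the line runs one-dimensional renewal theory on the Duminil-Copin–Smirnov bridge
sequence `B_h = HV.stripBlim h = sup_L B_{h,L}(x_c)` (`HexSAWLowerBound.lean`); here the bridges of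
the kernel at the door `(0,0)`, `bridgeMassOf kernel 0 0 h W = Σ_{|j| ≤ W} Σ_{β : top_{h,j} → door} x_c^{ℓ(β)}`
(`NoSplit 0 h h` is vacuous), are identified with them:

* reversing a box walk (read from the top edge down to the door) and passing to the coordinate
  model `HV` by `toHV` (`toBridge`; dictionary `row = x₁`, `pos = 2x₀ + x₁ + bit`, door vertex
  `bv 0 0 ↦ hvOrigin`) gives a bridge of the strip `S_{h, W+h}` in the sense of `HV.bridgeLists`
  (`toBridge_mem`: the last vertex `bv (h-1) j` has level `2h - 1` because `top` is an edge),
  injectively (`toBridge_injective`);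
* conversely every bridge of `S_{h,L}` is the bridge of a box walk of window `W = 2L + h`
  (`exists_eq_toBridge`, built with `Negative.mkSAW`);
* hence `bridgeMass 0 0 h W ≤ B_{h,W+h}(x_c) ≤ B_h` (`stripB_le_lim` with the discharged
  `DuminilCopinSmirnov2012_lemma2_holds`) and `B_{h,L}(x_c) ≤ bridgeMass 0 0 h (2L+h)`, so that the
  bridges approximate `B_h = sup_L B_{h,L}` from below (`exists_lt_of_lt_ciSup`).

The final theorem `stub_bridgeDictionary` assembles conjuncts (i)–(v).

Sources: H. Duminil-Copin, S. Smirnov, Ann. of Math. 175 (2012) (arXiv:1007.0575) §3 (bridges of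
`S_{T,L}`); N. Madras, G. Slade, *The Self-Avoiding Walk* (1993) §4.2.
-/

noncomputable section

namespace Summit.CriticalPhenomena.SAWScalingLimit.Theorems.MassRatio.Renewal

open Literature.Probability.LatticeModels Literature.Probability.RandomPlanarGeometry
open Literature.Probability.RandomPlanarGeometry.SAW
open Summit.CriticalPhenomena.SAWScalingLimit.Theorems.MassRatio.Negative

namespace BridgeDictionary
/-! ### (iii)/(iv) The coordinate dictionary: box walks at the door `(0,0)` and DCS bridges -/

/-- The row is the second coordinate in the model `HV`. [folklore] -/
theorem toHV_row (v : HexVertex) : (toHV v).2.1 = row v := rfl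

/-- The type bit of the model is `0` or `1`. [folklore] -/
theorem bit_bounds (u : HV) : 0 ≤ HV.bit u ∧ HV.bit u ≤ 1 := by
  unfold HV.bit; split_ifs <;> simp

/-- The position in terms of the coordinates of the model: `pos = 2 x₀ + x₁ + bit`. [folklore] -/
theorem pos_eq_toHV (v : HexVertex) :
    pos v = 2 * (toHV v).1 + (toHV v).2.1 + HV.bit (toHV v) := by
  obtain ⟨x, i⟩ := v
  simp only [pos, toHV, HV.bit]
  fin_cases i <;> simp

/-- The type bit is the parity of `pos - row`. [folklore] -/
theorem bit_toHV (v : HexVertex) : HV.bit (toHV v) = (pos v - row v) % 2 := by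
  have h1 := pos_eq_toHV v
  have h2 := bit_bounds (toHV v)
  have h3 := toHV_row v
  omega

/-- The row of a model vertex. [folklore] -/
theorem row_ofHV (u : HV) : row (ofHV u) = u.2.1 := by
  rw [← toHV_row (ofHV u), toHV_ofHV]

/-- The position of a model vertex. [folklore] -/
theorem pos_ofHV (u : HV) : pos (ofHV u) = 2 * u.1 + u.2.1 + HV.bit u := by
  rw [pos_eq_toHV, toHV_ofHV]

/-- The door vertex `(0,0)` is the origin of the model. [folklore] -/
theorem ofHV_hvOrigin : ofHV hvOrigin = bv 0 0 := by
  rw [← bv_row_pos (ofHV hvOrigin), row_ofHV, pos_ofHV]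
  simp [hvOrigin]

/-- The origin of the model is the door vertex `(0,0)`. [folklore] -/
theorem toHV_bv_zero : toHV (bv 0 0) = hvOrigin := by
  rw [← ofHV_hvOrigin, toHV_ofHV]

/-- `ofHV` is injective. [folklore] -/
theorem ofHV_injective : Function.Injective ofHV :=
  Function.LeftInverse.injective (g := toHV) fun u => toHV_ofHV u

/-- Box walks at the door `(0,0)` of height `h` and window `W`, over all top offsets `j`.
[folklore] -/
abbrev BoxWalk (h W : ℕ) : Type :=
  Σ j : ℤ, HexMidEdgeSAW (box 0 0 h W) (top 0 0 h j) (door 0 0)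

/-- The DCS bridge of a box walk: reverse it (door → top) and pass to the model `HV`.
[folklore] -/
def toBridge {h W : ℕ} (x : BoxWalk h W) : List HV := (x.2.verts.map toHV).reverse

/-- The length of the bridge is the length of the walk. [folklore] -/
theorem length_toBridge {h W : ℕ} (x : BoxWalk h W) : (toBridge x).length = x.2.length := by
  simp [toBridge, HexMidEdgeSAW.length]

/-- A box walk (`h ≥ 1`) is a nonempty list from the inner top vertex `bv (h-1) j` to the inner
door vertex `bv 0 0`, and its top edge is an edge of `ℍ`. [folklore] -/
theorem boxWalk_ends {h W : ℕ} (hh : 1 ≤ h) {j : ℤ}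
    (β : HexMidEdgeSAW (box 0 0 h W) (top 0 0 h j) (door 0 0)) :
    ∃ hne : β.verts ≠ [], β.verts.head hne = bv (0 + h - 1) (0 + j) ∧
      β.verts.getLast hne = bv 0 0 ∧ (0 + j - (0 + (h : ℤ))) % 2 = 0 := by
  have hne : β.verts ≠ [] := fun h0 => top_ne_door hh (β.eq_of_nil h0)
  refine ⟨hne, ?_, ?_, adj_top_iff.1 ((SimpleGraph.mem_edgeSet _).1 β.fst_mem.1)⟩
  · have h1 := β.head_mem _ (List.head?_eq_some_head hne)
    have h2 := β.subset _ (List.head_mem hne)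
    simp only [top, Sym2.mem_iff] at h1
    rcases h1 with h1 | h1
    · exfalso; rw [h1, mem_box, row_bv] at h2; omega
    · exact h1
  · have h1 := β.getLast_mem _ (List.getLast?_eq_some_getLast hne)
    have h2 := β.subset _ (List.getLast_mem hne)
    simp only [door, Sym2.mem_iff] at h1
    rcases h1 with h1 | h1
    · exfalso; rw [h1, mem_box, row_bv] at h2; omega
    · exact h1

/-- `toBridge` is injective (`h ≥ 1`): the vertex list determines the walk, and the offset `j` is
the position of its first vertex. [folklore] -/
theorem toBridge_injective {h W : ℕ} (hh : 1 ≤ h) : Function.Injective (toBridge (h := h) (W := W)) := by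
  rintro ⟨j, β⟩ ⟨j', β'⟩ hxy
  have hv : β.verts = β'.verts := by
    have := congrArg List.reverse hxy
    simp only [toBridge, List.reverse_reverse] at this
    exact List.map_injective_iff.2 hvEquiv.injective this
  obtain ⟨hne, hhd, -, -⟩ := boxWalk_ends hh β
  obtain ⟨hne', hhd', -, -⟩ := boxWalk_ends hh β'
  have hj : j = j' := by
    have e1 : β.verts.head hne = β'.verts.head hne' := by simp only [hv]
    rw [hhd, hhd'] at e1
    have := (bv_inj e1).2
    omega
  subst hj
  obtain rfl : β = β' := HexMidEdgeSAW.ext hv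
  rfl

/-- The bridge of a box walk of height `h ≥ 1` and window `W` is a DCS bridge of the strip
`S_{h, W+h}`. [folklore] -/
theorem toBridge_mem {h W : ℕ} (hh : 1 ≤ h) (x : BoxWalk h W) :
    toBridge x ∈ HV.bridgeLists h (W + h) := by
  obtain ⟨j, β⟩ := x
  obtain ⟨hne, hhd, hlast, hpar⟩ := boxWalk_ends hh β
  rw [HV.mem_bridgeLists_iff hh]
  refine ⟨?_, ?_, ?_, ?_, ?_⟩
  · simp only [toBridge]
    rw [List.isChain_reverse, List.isChain_map]
    exact β.isChain.imp fun a b hab => (hexGraph_adj_iff_hvGraph_adj b a).1 hab.symm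
  · simp only [toBridge]
    rw [List.head?_reverse, List.getLast?_map, List.getLast?_eq_some_getLast hne, hlast, Option.map_some,
      toHV_bv_zero]
  · simp only [toBridge]
    exact List.nodup_reverse.2 (β.nodup.map hvEquiv.injective)
  · intro u hu
    simp only [toBridge, List.mem_reverse, List.mem_map] at hu
    obtain ⟨v, hv, rfl⟩ := hu
    have hb := β.subset v hv
    rw [mem_box] at hb
    rw [HV.mem_stripV_iff, HV.lev]
    have e1 := toHV_row v
    have e2 := pos_eq_toHV v
    have e3 := bit_bounds (toHV v)
    push_cast
    omega
  · have hne' : toBridge ⟨j, β⟩ ≠ [] := by simpa [toBridge] using hne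
    refine ⟨hne', ?_⟩
    have : (toBridge ⟨j, β⟩).getLast hne' = toHV (bv (0 + h - 1) (0 + j)) := by
      simp only [toBridge, List.getLast_reverse, List.head_map, hhd]
    rw [this, HV.lev, toHV_row, bit_toHV, row_bv, pos_bv]
    omega

/-- Every DCS bridge of `S_{h,L}` (`h ≥ 1`) is the bridge of a box walk of window `W = 2L + h`,
whose top offset lies in `[-W, W]`. [folklore] -/
theorem exists_eq_toBridge {h L : ℕ} (hh : 1 ≤ h) {l : List HV} (hl : l ∈ HV.bridgeLists h L) :
    ∃ x : BoxWalk h (2 * L + h),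
      x.1 ∈ Finset.Icc (-((2 * L + h : ℕ) : ℤ)) ((2 * L + h : ℕ) : ℤ) ∧ toBridge x = l := by
  rw [HV.mem_bridgeLists_iff hh] at hl
  obtain ⟨hc, hhd, hnd, hV, hne, hlev⟩ := hl
  set W : ℕ := 2 * L + h with hW
  set u : HV := l.getLast hne with hu
  set j : ℤ := pos (ofHV u) with hj
  have hbu := bit_bounds u
  have huV : u ∈ HV.stripV h L := hV u (List.getLast_mem hne)
  rw [HV.mem_stripV_iff] at huV
  rw [HV.lev] at hlev
  have hju : j = 2 * u.1 + u.2.1 + HV.bit u := by rw [hj, pos_ofHV]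
  have hjW : -(W : ℤ) ≤ j ∧ j ≤ W := by rw [hW]; push_cast; omega
  -- the vertex list of the box walk
  set verts : List HexVertex := (l.map ofHV).reverse with hverts
  have hvne : verts ≠ [] := by simpa [hverts] using hne
  have hsub : ∀ v ∈ verts, v ∈ box 0 0 h W := by
    intro v hv
    simp only [hverts, List.mem_reverse, List.mem_map] at hv
    obtain ⟨u', hu', rfl⟩ := hv
    have h1 := hV u' hu'
    rw [HV.mem_stripV_iff, HV.lev] at h1
    have h2 := bit_bounds u'
    rw [mem_box, row_ofHV, pos_ofHV, hW]
    push_cast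
    omega
  have hvnd : verts.Nodup := List.nodup_reverse.2 (hnd.map ofHV_injective)
  have hvch : verts.IsChain hexGraph.Adj := by
    rw [hverts, List.isChain_reverse, List.isChain_map]
    exact hc.imp fun a b hab => (hexGraph_adj_iff_hvGraph_adj _ _).2
      (by rw [toHV_ofHV, toHV_ofHV]; exact hab.symm)
  have hou : ofHV u = bv (0 + h - 1) (0 + j) := by
    rw [← bv_row_pos (ofHV u), row_ofHV, ← hj]
    congr 1 <;> omega
  have hhead : verts.head hvne = bv (0 + h - 1) (0 + j) := by
    rw [← hou]
    simp only [hverts, List.head_reverse, List.getLast_map, hu]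
  have hl0 : l.head hne = hvOrigin := by
    rw [List.head?_eq_some_head hne] at hhd
    exact Option.some_inj.1 hhd
  have hlast : verts.getLast hvne = bv 0 0 := by
    rw [← ofHV_hvOrigin, ← hl0]
    simp only [hverts, List.getLast_reverse, List.head_map]
  have huw : hexGraph.Adj (bv (0 + h) (0 + j)) (bv (0 + h - 1) (0 + j)) := by
    rw [adj_top_iff]; omega
  have hw : bv (0 + h - 1) (0 + j) ∈ box 0 0 h W := by
    rw [← hhead]; exact hsub _ (List.head_mem hvne)
  have hnu : bv (0 + h) (0 + j) ∉ verts := fun hmem => by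
    have := hsub _ hmem
    rw [mem_box, row_bv] at this
    omega
  have hz : ∃ v ∈ door 0 0, v ∉ verts := by
    refine ⟨bv (0 - 1) 0, by rw [door]; exact Sym2.mem_mk_left _ _, fun hmem => ?_⟩
    have := hsub _ hmem
    rw [mem_box, row_bv] at this
    omega
  have haz : s(bv (0 + (h : ℤ)) (0 + j), bv (0 + h - 1) (0 + j)) ≠ door 0 0 := top_ne_door hh
  let β : HexMidEdgeSAW (box 0 0 h W) (top 0 0 h j) (door 0 0) :=
    mkSAW (box 0 0 h W) (bv (0 + h) (0 + j)) (bv (0 + h - 1) (0 + j)) (door 0 0) verts hvne hsub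
      hvnd hvch hhead (by rw [hlast, door]; exact Sym2.mem_mk_right _ _) huw hw hnu hz haz
  refine ⟨⟨j, β⟩, Finset.mem_Icc.2 hjW, ?_⟩
  show ((l.map ofHV).reverse.map toHV).reverse = l
  rw [List.map_reverse, List.reverse_reverse, List.map_map]
  exact List.map_id'' (fun v => toHV_ofHV v) l

open scoped Classical in
/-- The bridge mass at the door `(0,0)` as a sum over all box walks (`NoSplit 0 h h` is vacuous).
[folklore] -/
theorem bridgeMass_eq_sum (h W : ℕ) :
    bridgeMassOf kernel 0 0 h W =
      ∑ x ∈ (Finset.Icc (-(W : ℤ)) W).sigma (fun _ => Finset.univ),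
        hexCriticalFugacity ^ (toBridge (h := h) (W := W) x).length := by
  rw [bridgeMassOf, Finset.sum_sigma]
  refine Finset.sum_congr rfl fun j _ => ?_
  unfold kernel
  refine Finset.sum_congr rfl fun β _ => ?_
  have hns : NoSplit 0 h h β.verts := fun h' h1 h2 => absurd (lt_of_le_of_lt h1 h2) (lt_irrefl _)
  rw [if_pos hns, length_toBridge]

/-- (iii, finite form) `bridgeMass 0 0 h W ≤ B_{h, W+h}(x_c)`. [folklore] -/
theorem bridgeMass_le_stripB {h : ℕ} (hh : 1 ≤ h) (W : ℕ) :
    bridgeMassOf kernel 0 0 h W ≤ HV.stripB h (W + h) hexCriticalFugacity := by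
  rw [bridgeMass_eq_sum, HV.stripB_eq_sum_bridgeLists hh]
  exact HV.sum_le_sum_of_injOn_of_nonneg toBridge ((toBridge_injective hh).injOn)
    (fun x _ => toBridge_mem hh x) _ fun _ _ => pow_nonneg hexCriticalFugacity_pos_lt_one.1.le _

/-- (iv, finite form) `B_{h, L}(x_c) ≤ bridgeMass 0 0 h (2L + h)`. [folklore] -/
theorem stripB_le_bridgeMass {h : ℕ} (hh : 1 ≤ h) (L : ℕ) :
    HV.stripB h L hexCriticalFugacity ≤ bridgeMassOf kernel 0 0 h (2 * L + h) := by
  rw [bridgeMass_eq_sum, HV.stripB_eq_sum_bridgeLists hh,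
    ← Finset.sum_image (f := fun l : List HV => hexCriticalFugacity ^ l.length)
      ((toBridge_injective hh).injOn)]
  refine Finset.sum_le_sum_of_subset_of_nonneg (fun l hl => ?_)
    fun _ _ _ => pow_nonneg hexCriticalFugacity_pos_lt_one.1.le _
  obtain ⟨x, hx, rfl⟩ := exists_eq_toBridge hh hl
  exact Finset.mem_image.2 ⟨x, Finset.mem_sigma.2 ⟨hx, Finset.mem_univ _⟩, rfl⟩

/-- (iii) The bridges at the door `(0,0)` are bounded by `B_h`. [folklore] -/
theorem bridgeMass_le_stripBlim {h : ℕ} (W : ℕ) (hh : 1 ≤ h) :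
    bridgeMassOf kernel 0 0 h W ≤ HV.stripBlim h :=
  (bridgeMass_le_stripB hh W).trans (stripB_le_lim DuminilCopinSmirnov2012_lemma2_holds hh _)

/-- (iv) The bridges at the door `(0,0)` approximate `B_h` from below as `W → ∞`. [folklore] -/
theorem exists_bridgeMass_ge {h : ℕ} (hh : 1 ≤ h) {ε : ℝ} (hε : 0 < ε) :
    ∃ W : ℕ, HV.stripBlim h - ε ≤ bridgeMassOf kernel 0 0 h W := by
  have hlt : HV.stripBlim h - ε < ⨆ L : ℕ, HV.stripB h L hexCriticalFugacity := by
    show HV.stripBlim h - ε < HV.stripBlim h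
    linarith
  obtain ⟨L, hL⟩ := exists_lt_of_lt_ciSup hlt
  exact ⟨2 * L + h, (hL.le.trans (stripB_le_bridgeMass hh L))⟩

end BridgeDictionary

/-- **Stub 3a — the bridge dictionary**: translation invariance and window-monotonicity of the
kernel, the identification of box bridges at the door `(0,0)` with the DCS strip bridges
`B_h = HV.stripBlim h` (upper bound and approximation from below), and the vanishing of the
kernel at non-edges. [folklore] -/
theorem stub_bridgeDictionary : BridgeDictionary kernel HV.stripBlim := by
  refine ⟨fun m p t W h j hmp => BridgeDictionary.kernel_transl hmp t W h j,
    fun m p t W W' h j hW => BridgeDictionary.kernel_mono_W m p t h j hW,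
    fun h W hh => BridgeDictionary.bridgeMass_le_stripBlim W hh,
    fun h hh ε hε => BridgeDictionary.exists_bridgeMass_ge hh hε,
    fun m p t W h j hpar => BridgeDictionary.kernel_eq_zero_of_parity hpar⟩

end Summit.CriticalPhenomena.SAWScalingLimit.Theorems.MassRatio.Renewal
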